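import Summits.QuantumAdvantage.QuantumAdvantage.Theorems.CubicForrelationNearExactIsExactTwelveTypeO896PartnerB

/-!
# Crux `CubicForrelation.NearExactIsExact` (stmt-QuantumAdvantage-14043) — n = 12: NO type-O side with base set `896` above `29/32`
  (gen 18's `to18_typeO_E896_ge932_false` re-run with the budget `Σ τ² < 12288`); a type-O side with `#E = 896` has `Φ ≤ 29/32`

Certificate seat `b2b-cforr-cert` (gen 19).  HONEST FRAMING: kernel-checked lemmas (standard axioms) for the type-O branch of the rungs
`931/1024 … 929/1024` at `n = 12`; nothing is closed here, NO new value of `θ₁₂`.  NOT summit progress.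

`to19_typeO_E896_gt2932_false`: by `to19_typeO_E896_partner` the partner `f` of a type-O side with `#E = 896` at `Φ > 29/32` is at level
exactly 5: `W_f = 32k'` with `k' = u_f/2` odd somewhere; the parity of `k'` is AFFINE (`stub_walshTower stub_axParity` at level 5, degree 1), so
its odd set has `≥ 2048` points (Reed–Muller).  But the partner identity gives `v̂(y) = 16·(2A(y) − k'(y))` with `A(y) ∈ ℤ`, so `v̂(y)² ≥ 256` on
the odd set, while `Σ v̂² = 4096·Σv² ≤ 4096·63` allows at most `1008` such points.  Hence `to19_typeO_E896_le_2932`: a type-O side with base set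
`896` has `Φ ≤ 29/32 = 928/1024` — four grid steps below gen 18's `932/1024`; together with `…TwelveTypeO931Shape` / Kasami–Tokura for cubics
(`kt3_weights_twelve`) the type-O base set on `(29/32, 932/1024)` is `512` (only below `931/1024`), `960`, or `992` (only up to `930/1024`).

References: Kasami–Tokura (1970); MacWilliams–Sloane (1977) Ch. 13, 15; Carlet (2021) §5.2.  Axioms: the standard three.
-/

set_option linter.dupNamespace false -- D-0017: single-problem summit ⇒ `QuantumAdvantage.QuantumAdvantage` by design

noncomputable section

namespace Summit.QuantumAdvantage.QuantumAdvantage.Theorems.CubicForrelation.NearExactIsExact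

open Finset
open Literature.Computability.QuantumComplexity
open Literature.Computability.QuantumComplexity.BuzetChailloux (bxor zeroVec bxor_bxor_cancel_left bxor_zeroVec zeroVec_bxor bxor_comm
  bxor_self twist_zeroVec_right twist_bxor_right)
open Literature.Computability.QuantumComplexity.DerivativeWalsh (W sum_W_sq)
open Literature.Computability.QuantumComplexity.Simon (twist_eq_one_or)
open Summit.QuantumAdvantage.QuantumAdvantage.Theorems.NearExactIsExact.Negative (TypeOTwelve.typeO_of_exists_odd)

/-- **No type-O side with base set `896` above `29/32`** (given the partner's Ax-level data `W_f = 16u_f`).  See the module docstring.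
NOT summit progress. [this work] -/
theorem to19_typeO_E896_gt2932_false (f g : (Fin (6 + 6) → Bool) → Bool) (hf : IsDegLeFun 3 f) (hg : IsDegLeFun 3 g)
    (u : (Fin (6 + 6) → Bool) → ℤ) (hu : ∀ x, W (fun y => signOf (g y)) x = (2 : ℝ) ^ 4 * (u x : ℝ))
    (hodd : ∃ x, Odd (u x)) (hE : #(univ.filter fun x : Fin (6 + 6) → Bool => (Odd (u x / 2) ↔ Odd (u x / 2 / 2))) = 896)
    (hΦ : (29 / 32 : ℝ) < forrelation f g)
    (uf : (Fin (6 + 6) → Bool) → ℤ) (huf : ∀ y, W (fun x => signOf (f x)) y = (2 : ℝ) ^ 4 * (uf y : ℝ)) :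
    False := by
  classical
  have hall : ∀ x, Odd (u x) := TypeOTwelve.typeO_of_exists_odd g u hg hu hodd
  have hu' : ∀ x, W (fun y => signOf (g y)) x = (2 : ℝ) ^ (2 * 2) * (u x : ℝ) := fun x => (hu x).trans (by norm_num)
  have hd1 : IsDegLeFun 1 (fun x => decide (Odd (u x / 2))) := z2_digitOne 2 g u hg hu' hall
  have hd2 : IsDegLeFun 3 (fun x => decide (Odd (u x / 2 / 2))) := z2_digitTwo 2 g u hg hu' hall
  obtain ⟨c₁, b₁, hcb⟩ := stub_affineForm (6 + 6) _ hd1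
  set E := univ.filter (fun x : Fin (6 + 6) → Bool => (Odd (u x / 2) ↔ Odd (u x / 2 / 2))) with hEdef
  have hdegE : IsDegLeFun (2 + 1) (fun x => (decide (Odd (u x / 2)) ^^ decide (Odd (u x / 2 / 2))) ^^ true) :=
    tb_isDegLeFun_xor_const (bb_isDegLeFun_bxor (hd1.mono (by norm_num)) hd2) true
  have hsetE : (univ.filter fun x : Fin (6 + 6) → Bool =>
      ((decide (Odd (u x / 2)) ^^ decide (Odd (u x / 2 / 2))) ^^ true) = true) = E := by
    rw [hEdef]
    apply filter_congr
    intro x _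
    by_cases h1 : Odd (u x / 2) <;> by_cases h2 : Odd (u x / 2 / 2) <;> simp [h1, h2]
  have hsumE : (∑ x, (if (Odd (u x / 2) ↔ Odd (u x / 2 / 2)) then 1 else 0 : ℤ)) = #E := by rw [sum_boole]
  -- budget and the wild function
  have hbud := tw12_budget f g u hu
  have hT : (∑ x, (u x - 4 * sZ (f x)) ^ 2 : ℤ) ≤ 12287 := by
    have h' : ((∑ x, (u x - 4 * sZ (f x)) ^ 2 : ℤ) : ℝ) < 12288 := by rw [hbud]; linarith
    have h'' : (∑ x, (u x - 4 * sZ (f x)) ^ 2 : ℤ) < 12288 := by exact_mod_cast h'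
    omega
  choose v hv using fun x => to12_pt_mod8 (u x) (sZ (f x)) (hall x) (tp_sZ_cases (f x))
  set τ₀ : (Fin (6 + 6) → Bool) → ℤ := fun x =>
    sZ (decide (Odd (u x / 2))) * (1 - 4 * (if (Odd (u x / 2) ↔ Odd (u x / 2 / 2)) then 1 else 0)) with hτ₀def
  have hvx : ∀ x, u x - 4 * sZ (f x) = τ₀ x + 8 * v x := fun x => hv x
  have hτ₀val : ∀ x, τ₀ x = 1 ∨ τ₀ x = -1 ∨ τ₀ x = 3 ∨ τ₀ x = -3 := by
    intro x
    simp only [τ₀]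
    rcases tp_sZ_cases (decide (Odd (u x / 2))) with h | h <;> rw [h] <;> split_ifs <;> norm_num
  have hτ₀sq : ∀ x, τ₀ x ^ 2 = 1 + 8 * (if (Odd (u x / 2) ↔ Odd (u x / 2 / 2)) then 1 else 0 : ℤ) := by
    intro x
    simp only [τ₀]
    rcases tp_sZ_cases (decide (Odd (u x / 2))) with h | h <;> rw [h] <;> split_ifs <;> norm_num
  have hsumτ₀ : ∑ x, τ₀ x ^ 2 = 11264 := by
    rw [sum_congr rfl fun x _ => hτ₀sq x, sum_add_distrib, ← mul_sum, hsumE, sum_const, card_univ, Fintype.card_fun,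
      Fintype.card_bool, Fintype.card_fin]
    change (4096 : ℕ) • (1 : ℤ) + 8 * ((#E : ℕ) : ℤ) = 11264
    rw [hE]; norm_num
  -- `X ≥ 16 v²` pointwise, hence `Σ v² ≤ 63`
  have hX16 : ∀ x, 16 * v x ^ 2 ≤ (τ₀ x + 8 * v x) ^ 2 - τ₀ x ^ 2 := by
    intro x
    have hv3 : v x = 0 ∨ 1 ≤ v x ∨ v x ≤ -1 := by omega
    rcases hv3 with h0 | h1 | h1
    · rw [h0]; ring_nf; rfl
    · rcases hτ₀val x with h | h | h | h <;> rw [h] <;> nlinarith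
    · rcases hτ₀val x with h | h | h | h <;> rw [h] <;> nlinarith
  have hTdec : (∑ x, (u x - 4 * sZ (f x)) ^ 2 : ℤ) = ∑ x, τ₀ x ^ 2 + ∑ x, ((τ₀ x + 8 * v x) ^ 2 - τ₀ x ^ 2) := by
    rw [← sum_add_distrib]
    exact sum_congr rfl fun x _ => by rw [hvx x]; ring
  have hv2 : ∑ x, v x ^ 2 ≤ 63 := by
    have h1 : 16 * ∑ x, v x ^ 2 ≤ ∑ x, ((τ₀ x + 8 * v x) ^ 2 - τ₀ x ^ 2) := by rw [mul_sum]; exact sum_le_sum fun x _ => hX16 x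
    rw [hTdec, hsumτ₀] at hT
    linarith
  -- `v ≢ 0` (else `Φ = 936/1024`)
  have hvne : ∃ x, v x ≠ 0 := by
    by_contra hnone
    push Not at hnone
    have hT0 : (∑ x, (u x - 4 * sZ (f x)) ^ 2 : ℤ) = 11264 := by
      rw [hTdec, hsumτ₀, sum_eq_zero fun x _ => by rw [hnone x]; ring]; ring
    have hΦ936 : forrelation f g = 936 / 1024 := by
      have : ((11264 : ℤ) : ℝ) = (2 : ℝ) ^ 17 * (1 - forrelation f g) := by rw [← hT0]; exact hbud
      norm_num at this; linarith
    exact to18_typeO_ge936_false f g hf hg u hu hodd (by rw [hΦ936])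
  -- Parseval for `v`
  set Vh : (Fin (6 + 6) → Bool) → ℝ := fun y => ∑ x, (v x : ℝ) * twist x y with hVh
  have hParsV : ∑ y, Vh y ^ 2 = 4096 * ((∑ x, v x ^ 2 : ℤ) : ℝ) := by
    have h := sum_W_sq (n := 6 + 6) (fun x => (v x : ℝ))
    unfold W at h
    rw [h]; push_cast; norm_num
  -- the partner identity with `Ê ∈ 128ℤ`: `Vh(y) = 8·(4 sg − 64 s_b [c₁ ⊕ y = 0] + 8 s_b m − u_f(y))`
  have hsb : signOf b₁ = 1 ∨ signOf b₁ = -1 := by cases b₁ <;> simp [signOf]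
  have hid : ∀ y, ∃ m : ℤ, Vh y = 8 * (4 * signOf (g y) - 64 * signOf b₁ * (if bxor c₁ y = (fun _ => false) then (1 : ℝ) else 0) +
      8 * signOf b₁ * (m : ℝ) - (uf y : ℝ)) := by
    intro y
    have h := to18_typeO_partner_identity f g u hu v hv c₁ b₁ hcb uf huf y
    rw [← hEdef] at h
    obtain ⟨m, hm⟩ := to18_char_sum_E896 _ hdegE (by rw [hsetE]; exact hE) (bxor c₁ y)
    rw [hsetE] at hm
    rw [hm] at h
    refine ⟨m, ?_⟩
    simp only [Vh]
    split_ifs at h with hz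
    · rw [if_pos hz]; norm_num at h ⊢; linarith
    · rw [if_neg hz]; linarith
  -- the partner is at level exactly 5 (`to19_typeO_E896_partner`)
  obtain ⟨hev, hnot6⟩ := to19_typeO_E896_partner f g hf hg u hu hodd hE hΦ uf huf
  push Not at hnot6
  obtain ⟨y₁, hy₁⟩ := hnot6
  -- `u_f = 2k'`, `W_f = 32 k'`, and the parity of `k'` is AFFINE (the level-5 digit), so its odd set has `≥ 2048` points
  have huf' : ∀ y, W (fun x => signOf (f x)) y = (2 : ℝ) ^ 5 * (((uf y / 2 : ℤ)) : ℝ) := fun y => by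
    rw [tw_level_up f uf huf hev y]
  have hℓ : IsDegLeFun 1 (fun y => decide (Odd (uf y / 2))) :=
    stub_walshTower stub_axParity (6 + 6) 5 1 f (fun y => uf y / 2) hf huf' (by intro k hk hkn; omega)
  have hRM := bb_rmWeight_holds (6 + 6) 1 (fun y => decide (Odd (uf y / 2))) hℓ ⟨y₁, by simpa using hy₁⟩
  set Of := univ.filter (fun y : Fin (6 + 6) → Bool => decide (Odd (uf y / 2)) = true) with hOf
  have hOf2048 : (2048 : ℝ) ≤ #Of := by
    have h : 2048 ≤ #Of := by norm_num at hRM ⊢; omega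
    exact_mod_cast h
  -- on the odd set `Vh² ≥ 256`: `Vh = 16·K₂` with `K₂ = (even) − u_f/2` odd
  have hk2 : ∀ y, uf y = 2 * (uf y / 2) := fun y =>
    (Int.mul_ediv_cancel' (even_iff_two_dvd.1 (Int.not_odd_iff_even.1 (hev y)))).symm
  have hOfsq : ∀ y ∈ Of, (256 : ℝ) ≤ Vh y ^ 2 := by
    intro y hy
    have hyodd : Odd (uf y / 2) := by simpa [hOf] using (mem_filter.1 hy).2
    obtain ⟨j', hj'⟩ := hyodd
    obtain ⟨m, hm⟩ := hid y
    have hky : (uf y : ℝ) = 2 * (((uf y / 2 : ℤ)) : ℝ) := by exact_mod_cast hk2 y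
    rw [hky] at hm
    obtain ⟨K2, hK2, hK2odd⟩ : ∃ K2 : ℤ, Vh y = 16 * (K2 : ℝ) ∧ Odd K2 := by
      by_cases hz : bxor c₁ y = (fun _ => false)
      · rw [if_pos hz] at hm
        refine ⟨2 * sZ (g y) - 32 * sZ b₁ + 4 * sZ b₁ * m - uf y / 2, ?_, ⟨sZ (g y) - 16 * sZ b₁ + 2 * sZ b₁ * m - j' - 1, ?_⟩⟩
        · rw [hm]; push_cast; rw [tp_sZ_cast, tp_sZ_cast]; ring
        · rw [hj']; ring
      · rw [if_neg hz] at hm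
        refine ⟨2 * sZ (g y) + 4 * sZ b₁ * m - uf y / 2, ?_, ⟨sZ (g y) + 2 * sZ b₁ * m - j' - 1, ?_⟩⟩
        · rw [hm]; push_cast; rw [tp_sZ_cast, tp_sZ_cast]; ring
        · rw [hj']; ring
    have hK1 : (1 : ℝ) ≤ (K2 : ℝ) ^ 2 := by
      obtain ⟨j, hj⟩ := hK2odd
      have : K2 ≤ -1 ∨ 1 ≤ K2 := by omega
      have h2 : 1 ≤ K2 ^ 2 := by rcases this with h | h <;> nlinarith
      exact_mod_cast h2
    rw [hK2]; nlinarith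
  -- count: `256·#Of ≤ Σ Vh² = 4096 Σ v² ≤ 4096·63`
  have h1 : ∑ y ∈ Of, (256 : ℝ) ≤ ∑ y ∈ Of, Vh y ^ 2 := sum_le_sum hOfsq
  have h2 : ∑ y ∈ Of, Vh y ^ 2 ≤ ∑ y, Vh y ^ 2 := sum_le_sum_of_subset_of_nonneg (subset_univ _) fun y _ _ => sq_nonneg _
  rw [sum_const, nsmul_eq_mul] at h1
  rw [hParsV] at h2
  have h3 : ((∑ x, v x ^ 2 : ℤ) : ℝ) ≤ 63 := by exact_mod_cast hv2
  nlinarith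

/-- **No type-O side with base set `896` above `29/32`** (12 bits), packaged without the partner's Ax-level data.  NOT summit progress.
[this work] -/
theorem to19_typeO_E896_gt2932_false' (f g : (Fin (6 + 6) → Bool) → Bool) (hf : IsDegLeFun 3 f) (hg : IsDegLeFun 3 g)
    (u : (Fin (6 + 6) → Bool) → ℤ) (hu : ∀ x, W (fun y => signOf (g y)) x = (2 : ℝ) ^ 4 * (u x : ℝ))
    (hodd : ∃ x, Odd (u x)) (hE : #(univ.filter fun x : Fin (6 + 6) → Bool => (Odd (u x / 2) ↔ Odd (u x / 2 / 2))) = 896)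
    (hΦ : (29 / 32 : ℝ) < forrelation f g) : False := by
  obtain ⟨uf, huf⟩ := tw_base (n := 6 + 6) f hf 4 (by norm_num)
  exact to19_typeO_E896_gt2932_false f g hf hg u hu hodd hE hΦ uf huf

/-- **A type-O side with base set `896` has `Φ ≤ 29/32`** (12 bits): cubic `f, g`, `W_g = 16u`, some `u(x)` odd, `#E = 896` ⇒
`Φ(f,g) ≤ 29/32 = 928/1024`.  (Gen 18: `< 932/1024`.)  Finite-slice statement; NOT summit progress. [this work] -/
theorem to19_typeO_E896_le_2932 (f g : (Fin (6 + 6) → Bool) → Bool) (hf : IsDegLeFun 3 f) (hg : IsDegLeFun 3 g)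
    (u : (Fin (6 + 6) → Bool) → ℤ) (hu : ∀ x, W (fun y => signOf (g y)) x = (2 : ℝ) ^ 4 * (u x : ℝ))
    (hodd : ∃ x, Odd (u x)) (hE : #(univ.filter fun x : Fin (6 + 6) → Bool => (Odd (u x / 2) ↔ Odd (u x / 2 / 2))) = 896) :
    forrelation f g ≤ 29 / 32 := by
  by_contra h
  push Not at h
  exact to19_typeO_E896_gt2932_false' f g hf hg u hu hodd hE h

end Summit.QuantumAdvantage.QuantumAdvantage.Theorems.CubicForrelation.NearExactIsExact

end
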